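/-
Copyright (c) 2026 the pub-hodgecm-mathlib formalisation cell (harness21).  Prover seat hodgecm-mathlib-K2E1-p08 (g3), Track B ∕ K2-LIT
(build stream 29), h413 = `stmt-HodgeConjecture-24833`, line `K2_E1_TraceFormulaBeta`, row 18 (DEAL F ∕ G5: existence of globally matching test functions, CONDITIONAL);
dealer K2E1-plan (g2) RULING (β) 2026-09-04T02:28:20Z «skip G4, type G5 directly».  2026-09-04.
-/
import Summits.HodgeConjecture.HodgeConjecture.Theorems.K2E1GlobalTestFunctionsTwistedDefs   -- ★ `GlobalTestFunctionGt`, `locGt`, `localLevelGt`, `twistLocal`, `formAdelic`; ★ `GlobalTestFunction` (sibling)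
import Literature.NumberTheory.Rogawski1990.Ch4Sec10                                   -- ★ `TwistedTransferData`, `IsStableMatch` (4.10.2), `EpsOrbitalMeasureFamily`, `unitaryTwist`
import Literature.NumberTheory.Automorphic.LocalOrbitalIntegral                        -- ★ `OrbitalMeasureFamily`
import Literature.NumberTheory.Rogawski1990.TestFunctionsPair                           -- ★ `UnitaryGroup.PureTensor₂` (pure tensors on `H = U(H₂) × U(H₁)`)
import HarnessLib

/-!
# h413 ∕ Track B «K2-LIT», line `K2_E1_TraceFormulaBeta`, row 18 (G5) — **EXISTENCE OF GLOBALLY MATCHING TEST FUNCTIONS `φ̃ → f`, CONDITIONAL**: for every pure tensor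
# `φ̃ = φ̃_∞ ⊗ ⊗'_v φ̃_v` on `G̃(𝔸) = GL_n(𝔸_L)` there is a pure tensor `f = f_∞ ⊗ ⊗'_v f_v` on `G(𝔸) = U(H)(𝔸_{L⁺})` with `φ̃_v → f_v` ((4.10.2)) AT EVERY PLACE —
# from local existence (Prop. 4.10.1 (a)), the unit matching at almost all places (its Hecke clause for `𝟙`), and archimedean existence

Cell `pub/hodgecm-mathlib`, crux H413 = `stmt-HodgeConjecture-24833`, route of record `HCCMUnconditional`; chair K2-lead (g0), dealer K2E1-plan (g2) (RULING (β) on the G4 survey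
of K2E1-p08 (g3): «`MatchG` IS ★ `Ch12Sec7Bridge.SpectralTermsU3.withLocalMatchG` at `V = Option (Pl L)` — no parallel notion, no def-lane file; type G5 directly, kernel lane»).
THEOREMS ONLY (no `def`, no structure, no instance, no named-fact hypothesis smuggled as a `def`, no `sorry`); lane `--kind proof --supports stmt-HodgeConjecture-24833 --as helper`.

THE MATHEMATICS [Rogawski1990, §4.10 Prop. 4.10.1 (a) p. 58; §13.2 p. 200 «whenever `φ → f`»; §14.2 p. 233 `f = ⊗ f_v`].  The GLOBAL matching «`φ̃ → f`» of the twisted comparison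
is the PLACE-BY-PLACE relation (4.10.2) `Φ^st_ε(δ, φ̃_v) = Φ^st(γ, f_v)` for pure tensors (this is ★ `SpectralTermsU3.withLocalMatchG`'s `MatchG`, `Iff.rfl`, read at the place
index `Option (Pl L)` = finite places + `∞`; below it is spelled as the conjunction «`∀ v` finite» ∧ «at `∞`»).  Given `φ̃`, a matching `f` is ASSEMBLED from local
transfers: at the finitely many places where `φ̃_v ≠ 𝟙_{K̃_v}` or where the unit matching is not available take any smooth transfer `f_v` of `φ̃_v` (Prop. 4.10.1 (a),
existence: §4.12 `p`-adic); at all other places take `f_v = 𝟙_{K_v}` (Prop. 4.10.1 (a), Hecke clause «(4.10.2) holds with `f = ψ̂_G(φ)`» for the UNIT, `ψ̂_G(𝟙_{K̃_v}) = 𝟙_{K_v}` —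
the twisted fundamental lemma for the unit, [BR₁]); at `∞` take an archimedean transfer ([S₂] + [AC, §1.7]).  Exactly these three inputs are the HYPOTHESES (i)–(iii) of the
theorem, over a FAMILY of §4.10 data `𝔡 v : TwistedTransferData …` (one per finite place, one at `∞`) and PARAMETER measure families — nothing is pinned but the carriers
(★ `GlobalTestFunctionGt L⁺ L n` on `G̃`, ★ `GlobalTestFunction L N H` on `G`), the twists (★ `twistLocal L n Φ c v` at `v`, any `ε_∞` at `∞`) and the local-component maps
(★ `locGt φ̃ v = φ̃_v`, `f.fin v = f_v`); the transfer factors, `κ`, Kottwitz signs and orbital measures stay the shells' parameters.  Template: ★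
`UnitaryGroup.exists_globalTransferAwayH_of_isTest` (the `H`-side assembly away from the bad places).
* **`exists_globalTestFunction_isStableMatch`** — (i) ∀ v ∀ φ̃_v ★ `IsLocSmooth`, ∃ f_v ★ `IsLocSmooth` with `(𝔡 v).IsStableMatch … φ̃_v f_v`; (ii) `∀ᶠ v in cofinite,
  (𝔡 v).IsStableMatch … 𝟙_{K̃_v} 𝟙_{K_v}` (`K̃_v` = ★ `localLevelGt`, `K_v` = ★ `cmLocalIntegralLevel`); (iii) ∀ φ̃_∞ (continuous, compactly supported, ★ `IsArchSmooth`) ∃ f_∞ in the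
  archimedean currency of ★ `GlobalTestFunction` with `𝔡∞.IsStableMatch … φ̃_∞ f_∞` ⟹ **∀ φ̃ ∃ f : GlobalTestFunction L N H, (∀ v, (𝔡 v).IsStableMatch (mt v) (mG v) (locGt φ̃ v) (f.fin v))
  ∧ 𝔡∞.IsStableMatch mt∞ mG∞ φ̃.arch f.arch**.
* **`exists_pureTensor₂_isEndoMatch`** — the `H`-side twin «`φ̃ → φ̃^H`» ((4.10.3), ★ `IsEndoMatch`, Prop. 4.10.1 (b)): under (i') local existence, (ii') the unit matching
  `𝟙_{K̃_v} → 𝟙_{K₂,v × K₁,v}` a.e., (iii') archimedean existence, every `φ̃` has `φ̃^H : PureTensor₂ L H₂ H₁` (★ `TestFunctionsPair`, `H = U(H₂) × U(H₁)`) with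
  `(𝔡 v).IsEndoMatch … (locGt φ̃ v) (φ̃^H.loc v)` at every finite place, at `∞`, and `IsLocSmooth (φ̃^H.loc v)` everywhere.
NOT the `∞`-clause: E1b's `ArchPacketSignsLetter` (pseudo-coefficient SIGNS on `U(2,1)`) is not a matching relation (dealer's TABLE rows 18∕20 wording to be corrected).

HONEST LABEL.  CONDITIONAL assembly theorem (hypotheses (i)–(iii) are Prop. 4.10.1 (a) and the unit clause of its fundamental lemma, NOT proved here); closes no socket;
HC_CM is proved only modulo the 7 printed citations (2 remaining named inputs: hLiu418 = `stmt-HodgeConjecture-24832`, h413 = `stmt-HodgeConjecture-24833`) until rung 0 closes.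

## References
* [Rogawski1990] J. D. Rogawski, *Automorphic Representations of Unitary Groups in Three Variables* (1990), §4.10 Prop. 4.10.1 (a) p. 58, §4.12, §13.2 p. 200, §14.2 p. 233.
* [BlasiusRogawski1992] D. Blasius, J. Rogawski, *Fundamental lemmas for U(3) and related groups* ([BR₁] of print), in *The zeta functions of Picard modular surfaces* (1992).
* [ArthurClozel1989] J. Arthur, L. Clozel, *Simple algebras, base change, and the advanced theory of the trace formula* (1989), Ch. 1 §3, §1.7 (archimedean transfer).
-/

set_option autoImplicit false
-- the mandated namespace repeats `HodgeConjecture.HodgeConjecture`, as in every `Theorems/*.lean` of this sub-problem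
set_option linter.dupNamespace false

noncomputable section

open NumberField IsDedekindDomain Filter Topology Set
open scoped MatrixGroups Classical

namespace Summit.HodgeConjecture.HodgeConjecture.Cruxes.H413.K2E1MatchingTriplesConditional

open Literature.NumberTheory.Automorphic Literature.NumberTheory.Automorphic.UnitaryGroup
open Literature.NumberTheory.Rogawski1990 (IsLocSmooth isLocSmooth_indicator)
open Literature.NumberTheory.Rogawski1990.Ch4Sec10 (TwistedTransferData EpsOrbitalMeasureFamily epsCentralizer)
open Summit.HodgeConjecture.HodgeConjecture.Cruxes.H413.K2E1GlobalTestFunctions (GlobalTestFunction)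
open Summit.HodgeConjecture.HodgeConjecture.Cruxes.H413.K2E1GlobalTestFunctionsTwisted
open NumberField.mixedEmbedding (mixedSpace)

variable (L : Type) [Field L] [NumberField L] [IsCMField L] {n N : ℕ} (Φ : GL (Fin n) L) (c : L ≃ₐ[↥(maximalRealSubfield L)] L) (H : Matrix (Fin N) (Fin N) L)

/-- `𝟙_{K_v}` — the indicator of the integral level ★ `cmLocalIntegralLevel L N H v` (compact open) is ★ `IsLocSmooth`. [cite: Rogawski1990, §4.9 Prop. 4.9.1 (b) p. 55] -/
theorem isLocSmooth_indicator_cmLocalIntegralLevel (v : HeightOneSpectrum (𝓞 ↥(maximalRealSubfield L))) :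
    IsLocSmooth ((cmLocalIntegralLevel L N H v : Set ((cmDatum L N H).Local v)).indicator (1 : (cmDatum L N H).Local v → ℂ)) :=
  isLocSmooth_indicator (isCompact_isOpen_cmLocalIntegralLevel L N H v).2 (Subgroup.isClosed_of_isOpen _ (isCompact_isOpen_cmLocalIntegralLevel L N H v).2)
    (isCompact_isOpen_cmLocalIntegralLevel L N H v).1

/-- **EXISTENCE OF GLOBALLY MATCHING TEST FUNCTIONS «`φ̃ → f`» (CONDITIONAL on Prop. 4.10.1 (a) at every place and on the unit matching almost everywhere).**
Data: a §4.10 datum `𝔡 v` at every finite place `v` of `L⁺` for the twist `ε_v = twistLocal L n Φ c v` of `GL_n(L_v)` and the local group `U(H)(L⁺_v)`, twisted orbital measures `mt v`,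
orbital measures `mG v`; an archimedean datum `𝔡a` for any twist `εa` of `GL_n(L ⊗ ℝ)` and `U(H)(L⁺ ⊗ ℝ)`, with `mta`, `mGa`.  Hypotheses: (i) `hfin` — at every finite place every
★ `IsLocSmooth` `φ̃_v` has an ★ `IsLocSmooth` stable twisted transfer `f_v` [Prop. 4.10.1 (a), existence]; (ii) `hunit` — at almost every place the units match,
`𝟙_{K̃_v} → 𝟙_{K_v}` [Prop. 4.10.1 (a), Hecke clause for the unit; BR₁]; (iii) `harch` — every archimedean component has a transfer in the archimedean currency of
★ `GlobalTestFunction` [S₂; AC §1.7].  Conclusion: every `φ̃ : GlobalTestFunctionGt L⁺ L n` has an `f : GlobalTestFunction L N H` with `φ̃_v → f_v` ((4.10.2), ★ `IsStableMatch`)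
at EVERY finite place and `φ̃_∞ → f_∞` — i.e. `MatchG φ̃ f` in the sense of ★ `SpectralTermsU3.withLocalMatchG` read at the place index «finite places + ∞» (`Iff.rfl` there).
Proof: `f_v :=` the unit where `φ̃_v` is the unit and (ii) holds (a cofinite set, so `f` IS a pure tensor), a chosen local transfer elsewhere, `f_∞` from (iii).
[cite: Rogawski1990, §4.10 Prop. 4.10.1 (a) p. 58; §13.2 p. 200; §14.2 p. 233] -/
theorem exists_globalTestFunction_isStableMatch
    {Ht Hs CharM : HeightOneSpectrum (𝓞 ↥(maximalRealSubfield L)) → Type*} [∀ v, Group (Ht v)] [∀ v, Group (Hs v)]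
    {Z' : ∀ v : HeightOneSpectrum (𝓞 ↥(maximalRealSubfield L)), Subgroup (GL (Fin n) (LocalRing L v))}
    [∀ (v : HeightOneSpectrum (𝓞 ↥(maximalRealSubfield L))) (δ : GL (Fin n) (LocalRing L v)), MeasurableSpace (GL (Fin n) (LocalRing L v) ⧸ epsCentralizer (twistLocal L n Φ c v) δ)]
    [∀ (v : HeightOneSpectrum (𝓞 ↥(maximalRealSubfield L))) (γ : (cmDatum L N H).Local v),
      MeasurableSpace ((cmDatum L N H).Local v ⧸ Subgroup.centralizer ({γ} : Set ((cmDatum L N H).Local v)))]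
    (𝔡 : ∀ v : HeightOneSpectrum (𝓞 ↥(maximalRealSubfield L)),
      TwistedTransferData (GL (Fin n) (LocalRing L v)) ((cmDatum L N H).Local v) (Ht v) (Hs v) (CharM v) (twistLocal L n Φ c v) (Z' v))
    (mt : ∀ v : HeightOneSpectrum (𝓞 ↥(maximalRealSubfield L)), EpsOrbitalMeasureFamily (twistLocal L n Φ c v) (Z' v))
    (mG : ∀ v : HeightOneSpectrum (𝓞 ↥(maximalRealSubfield L)), OrbitalMeasureFamily ((cmDatum L N H).Local v))
    {Hta Hsa CharMa : Type*} [Group Hta] [Group Hsa] {εa : GL (Fin n) (mixedSpace L) →* GL (Fin n) (mixedSpace L)} {Za : Subgroup (GL (Fin n) (mixedSpace L))}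
    [∀ δ : GL (Fin n) (mixedSpace L), MeasurableSpace (GL (Fin n) (mixedSpace L) ⧸ epsCentralizer εa δ)]
    [∀ γ : UnitaryGroup.arch (↥(maximalRealSubfield L)) L (IsCMField.complexConj L) N H,
      MeasurableSpace (UnitaryGroup.arch (↥(maximalRealSubfield L)) L (IsCMField.complexConj L) N H ⧸
        Subgroup.centralizer ({γ} : Set (UnitaryGroup.arch (↥(maximalRealSubfield L)) L (IsCMField.complexConj L) N H)))]
    (𝔡a : TwistedTransferData (GL (Fin n) (mixedSpace L)) (UnitaryGroup.arch (↥(maximalRealSubfield L)) L (IsCMField.complexConj L) N H) Hta Hsa CharMa εa Za)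
    (mta : EpsOrbitalMeasureFamily εa Za) (mGa : OrbitalMeasureFamily (UnitaryGroup.arch (↥(maximalRealSubfield L)) L (IsCMField.complexConj L) N H))
    (hfin : ∀ (v : HeightOneSpectrum (𝓞 ↥(maximalRealSubfield L))) (φv : GL (Fin n) (LocalRing L v) → ℂ), IsLocSmooth φv →
      ∃ fv : (cmDatum L N H).Local v → ℂ, IsLocSmooth fv ∧ (𝔡 v).IsStableMatch (mt v) (mG v) φv fv)
    (hunit : ∀ᶠ v : HeightOneSpectrum (𝓞 ↥(maximalRealSubfield L)) in cofinite,
      (𝔡 v).IsStableMatch (mt v) (mG v) ((localLevelGt L n v : Set (GL (Fin n) (LocalRing L v))).indicator 1)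
        ((cmLocalIntegralLevel L N H v : Set ((cmDatum L N H).Local v)).indicator 1))
    (harch : ∀ φa : GL (Fin n) (mixedSpace L) → ℂ, Continuous φa → HasCompactSupport φa → IsArchSmooth (archGroupGL n L).carrier.subtype φa →
      ∃ fa : UnitaryGroup.arch (↥(maximalRealSubfield L)) L (IsCMField.complexConj L) N H → ℂ, Continuous fa ∧ HasCompactSupport fa ∧
        (∃ φ' : GL (Fin N) (mixedSpace L) → ℂ, Continuous φ' ∧ HasCompactSupport φ' ∧ IsArchSmooth (archGroupGL N L).carrier.subtype φ' ∧
          ∀ k : UnitaryGroup.arch (↥(maximalRealSubfield L)) L (IsCMField.complexConj L) N H, fa k = φ' (k : GL (Fin N) (mixedSpace L))) ∧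
        𝔡a.IsStableMatch mta mGa φa fa)
    (φ : GlobalTestFunctionGt (↥(maximalRealSubfield L)) L n) :
    ∃ f : GlobalTestFunction L N H, (∀ v, (𝔡 v).IsStableMatch (mt v) (mG v) (locGt φ v) (f.fin v)) ∧ 𝔡a.IsStableMatch mta mGa φ.arch f.arch := by
  -- the archimedean transfer (iii)
  obtain ⟨fa, hfac, hfas, hfaa, hfam⟩ := harch φ.arch φ.continuous_arch φ.hasCompactSupport_arch φ.isArchSmooth_arch
  -- local transfers (i) at every place, used only off the good set
  choose g hg using fun v => hfin v (φ.fin v) (φ.isLocSmooth_fin v)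
  -- the good (cofinite) set: `φ̃_v = 𝟙_{K̃_v}` and the unit matching (ii) holds
  have hP : ∀ᶠ v : HeightOneSpectrum (𝓞 ↥(maximalRealSubfield L)) in cofinite,
      φ.fin v = (localLevelGt L n v : Set (GL (Fin n) (LocalRing L v))).indicator 1 ∧
        (𝔡 v).IsStableMatch (mt v) (mG v) ((localLevelGt L n v : Set (GL (Fin n) (LocalRing L v))).indicator 1)
          ((cmLocalIntegralLevel L N H v : Set ((cmDatum L N H).Local v)).indicator 1) :=
    φ.fin_eventually_eq_indicator.and hunit
  -- the local factors: the unit on the good set, the chosen transfer elsewhere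
  let fv : ∀ v : HeightOneSpectrum (𝓞 ↥(maximalRealSubfield L)), (cmDatum L N H).Local v → ℂ := fun v =>
    if φ.fin v = (localLevelGt L n v : Set (GL (Fin n) (LocalRing L v))).indicator 1 ∧
        (𝔡 v).IsStableMatch (mt v) (mG v) ((localLevelGt L n v : Set (GL (Fin n) (LocalRing L v))).indicator 1)
          ((cmLocalIntegralLevel L N H v : Set ((cmDatum L N H).Local v)).indicator 1)
      then (cmLocalIntegralLevel L N H v : Set ((cmDatum L N H).Local v)).indicator 1 else g v
  have hfv_smooth : ∀ v, IsLocSmooth (fv v) := fun v => ?_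
  refine ⟨GlobalTestFunction.mk fa hfac hfas hfaa fv hfv_smooth (hP.mono fun v hv => if_pos hv), fun v => ?_, hfam⟩
  · -- the matching at `v`
    show (𝔡 v).IsStableMatch (mt v) (mG v) (φ.fin v) (fv v)
    by_cases hv : φ.fin v = (localLevelGt L n v : Set (GL (Fin n) (LocalRing L v))).indicator 1 ∧
        (𝔡 v).IsStableMatch (mt v) (mG v) ((localLevelGt L n v : Set (GL (Fin n) (LocalRing L v))).indicator 1)
          ((cmLocalIntegralLevel L N H v : Set ((cmDatum L N H).Local v)).indicator 1)
    · rw [show fv v = (cmLocalIntegralLevel L N H v : Set ((cmDatum L N H).Local v)).indicator 1 from if_pos hv, hv.1]; exact hv.2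
    · rw [show fv v = g v from if_neg hv]; exact (hg v).2
  · -- smoothness of the chosen local factors
    by_cases hv : φ.fin v = (localLevelGt L n v : Set (GL (Fin n) (LocalRing L v))).indicator 1 ∧
        (𝔡 v).IsStableMatch (mt v) (mG v) ((localLevelGt L n v : Set (GL (Fin n) (LocalRing L v))).indicator 1)
          ((cmLocalIntegralLevel L N H v : Set ((cmDatum L N H).Local v)).indicator 1)
    · rw [show fv v = (cmLocalIntegralLevel L N H v : Set ((cmDatum L N H).Local v)).indicator 1 from if_pos hv]
      exact isLocSmooth_indicator_cmLocalIntegralLevel L H v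
    · rw [show fv v = g v from if_neg hv]; exact (hg v).1

/-- **THE `H`-SIDE TWIN «`φ̃ → φ̃^H`» ((4.10.3); CONDITIONAL on Prop. 4.10.1 (b) at every place and on the unit matching almost everywhere).**  Same assembly for the
twisted ENDOSCOPIC transfer to `H = U(H₂) × U(H₁)` (print: `U(2) × U(1)`): data `𝔡 v` whose `H`-carrier is the local product group `U(H₂)(L⁺_v) × U(H₁)(L⁺_v)`, orbital measures
`mH v` on it, an archimedean datum `𝔡a` on `U(H₂)(L⁺ ⊗ ℝ) × U(H₁)(L⁺ ⊗ ℝ)`; hypotheses (i') local existence of ★ `IsLocSmooth` endoscopic transfers [Prop. 4.10.1 (b), §4.12],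
(ii') `∀ᶠ v, (𝔡 v).IsEndoMatch … 𝟙_{K̃_v} 𝟙_{K₂,v × K₁,v}` (`K_{i,v}` = ★ `cmLocalIntegralLevel`; the Hecke clause «(4.10.3) holds with `φ^H = η̂₁(φ)`» for the unit, [BR₁]),
(iii') archimedean existence.  Conclusion: every `φ̃` has `φ̃^H : PureTensor₂ L H₂ H₁` (bad set = the finitely many places off the good set, levels `K₂, K₁` = the integral
levels) with `(𝔡 v).IsEndoMatch (mt v) (mH v) (locGt φ̃ v) (φ̃^H.loc v)` at EVERY finite place, `IsLocSmooth (φ̃^H.loc v)` everywhere, and the matching at `∞`.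
[cite: Rogawski1990, §4.10 Prop. 4.10.1 (b) p. 58; §4.9 p. 54; §13.2 p. 200] -/
theorem exists_pureTensor₂_isEndoMatch {N₂ N₁ : ℕ} (H₂ : Matrix (Fin N₂) (Fin N₂) L) (H₁ : Matrix (Fin N₁) (Fin N₁) L)
    {G Ht CharM : HeightOneSpectrum (𝓞 ↥(maximalRealSubfield L)) → Type*} [∀ v, Group (G v)] [∀ v, Group (Ht v)]
    {Z' : ∀ v : HeightOneSpectrum (𝓞 ↥(maximalRealSubfield L)), Subgroup (GL (Fin n) (LocalRing L v))}
    [∀ (v : HeightOneSpectrum (𝓞 ↥(maximalRealSubfield L))) (δ : GL (Fin n) (LocalRing L v)), MeasurableSpace (GL (Fin n) (LocalRing L v) ⧸ epsCentralizer (twistLocal L n Φ c v) δ)]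
    [∀ (v : HeightOneSpectrum (𝓞 ↥(maximalRealSubfield L))) (γ : (cmDatum L N₂ H₂).Local v × (cmDatum L N₁ H₁).Local v),
      MeasurableSpace (((cmDatum L N₂ H₂).Local v × (cmDatum L N₁ H₁).Local v) ⧸
        Subgroup.centralizer ({γ} : Set ((cmDatum L N₂ H₂).Local v × (cmDatum L N₁ H₁).Local v)))]
    (𝔡 : ∀ v : HeightOneSpectrum (𝓞 ↥(maximalRealSubfield L)),
      TwistedTransferData (GL (Fin n) (LocalRing L v)) (G v) (Ht v) ((cmDatum L N₂ H₂).Local v × (cmDatum L N₁ H₁).Local v) (CharM v) (twistLocal L n Φ c v) (Z' v))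
    (mt : ∀ v : HeightOneSpectrum (𝓞 ↥(maximalRealSubfield L)), EpsOrbitalMeasureFamily (twistLocal L n Φ c v) (Z' v))
    (mH : ∀ v : HeightOneSpectrum (𝓞 ↥(maximalRealSubfield L)), OrbitalMeasureFamily ((cmDatum L N₂ H₂).Local v × (cmDatum L N₁ H₁).Local v))
    {Ga Hta CharMa : Type*} [Group Ga] [Group Hta] {εa : GL (Fin n) (mixedSpace L) →* GL (Fin n) (mixedSpace L)} {Za : Subgroup (GL (Fin n) (mixedSpace L))}
    [∀ δ : GL (Fin n) (mixedSpace L), MeasurableSpace (GL (Fin n) (mixedSpace L) ⧸ epsCentralizer εa δ)]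
    [∀ γ : UnitaryGroup.arch (↥(maximalRealSubfield L)) L (IsCMField.complexConj L) N₂ H₂ × UnitaryGroup.arch (↥(maximalRealSubfield L)) L (IsCMField.complexConj L) N₁ H₁,
      MeasurableSpace ((UnitaryGroup.arch (↥(maximalRealSubfield L)) L (IsCMField.complexConj L) N₂ H₂ ×
          UnitaryGroup.arch (↥(maximalRealSubfield L)) L (IsCMField.complexConj L) N₁ H₁) ⧸
        Subgroup.centralizer ({γ} : Set (UnitaryGroup.arch (↥(maximalRealSubfield L)) L (IsCMField.complexConj L) N₂ H₂ ×
          UnitaryGroup.arch (↥(maximalRealSubfield L)) L (IsCMField.complexConj L) N₁ H₁)))]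
    (𝔡a : TwistedTransferData (GL (Fin n) (mixedSpace L)) Ga Hta
      (UnitaryGroup.arch (↥(maximalRealSubfield L)) L (IsCMField.complexConj L) N₂ H₂ × UnitaryGroup.arch (↥(maximalRealSubfield L)) L (IsCMField.complexConj L) N₁ H₁)
      CharMa εa Za)
    (mta : EpsOrbitalMeasureFamily εa Za)
    (mHa : OrbitalMeasureFamily (UnitaryGroup.arch (↥(maximalRealSubfield L)) L (IsCMField.complexConj L) N₂ H₂ ×
      UnitaryGroup.arch (↥(maximalRealSubfield L)) L (IsCMField.complexConj L) N₁ H₁))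
    (hfin : ∀ (v : HeightOneSpectrum (𝓞 ↥(maximalRealSubfield L))) (φv : GL (Fin n) (LocalRing L v) → ℂ), IsLocSmooth φv →
      ∃ fHv : (cmDatum L N₂ H₂).Local v × (cmDatum L N₁ H₁).Local v → ℂ, IsLocSmooth fHv ∧ (𝔡 v).IsEndoMatch (mt v) (mH v) φv fHv)
    (hunit : ∀ᶠ v : HeightOneSpectrum (𝓞 ↥(maximalRealSubfield L)) in cofinite,
      (𝔡 v).IsEndoMatch (mt v) (mH v) ((localLevelGt L n v : Set (GL (Fin n) (LocalRing L v))).indicator 1)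
        (((cmLocalIntegralLevel L N₂ H₂ v : Set ((cmDatum L N₂ H₂).Local v)) ×ˢ (cmLocalIntegralLevel L N₁ H₁ v : Set ((cmDatum L N₁ H₁).Local v))).indicator
          fun _ => 1))
    (harch : ∀ φa : GL (Fin n) (mixedSpace L) → ℂ, Continuous φa → HasCompactSupport φa → IsArchSmooth (archGroupGL n L).carrier.subtype φa →
      ∃ fHa : UnitaryGroup.arch (↥(maximalRealSubfield L)) L (IsCMField.complexConj L) N₂ H₂ × UnitaryGroup.arch (↥(maximalRealSubfield L)) L (IsCMField.complexConj L) N₁ H₁ → ℂ,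
        𝔡a.IsEndoMatch mta mHa φa fHa)
    (φ : GlobalTestFunctionGt (↥(maximalRealSubfield L)) L n) :
    ∃ fH : PureTensor₂ L H₂ H₁, (∀ v, (𝔡 v).IsEndoMatch (mt v) (mH v) (locGt φ v) (fH.loc v)) ∧ (∀ v, IsLocSmooth (fH.loc v)) ∧
      𝔡a.IsEndoMatch mta mHa φ.arch fH.arch := by
  obtain ⟨fHa, hfHam⟩ := harch φ.arch φ.continuous_arch φ.hasCompactSupport_arch φ.isArchSmooth_arch
  choose g hg using fun v => hfin v (φ.fin v) (φ.isLocSmooth_fin v)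
  -- the good (cofinite) set
  have hP : ∀ᶠ v : HeightOneSpectrum (𝓞 ↥(maximalRealSubfield L)) in cofinite,
      φ.fin v = (localLevelGt L n v : Set (GL (Fin n) (LocalRing L v))).indicator 1 ∧
        (𝔡 v).IsEndoMatch (mt v) (mH v) ((localLevelGt L n v : Set (GL (Fin n) (LocalRing L v))).indicator 1)
          (((cmLocalIntegralLevel L N₂ H₂ v : Set ((cmDatum L N₂ H₂).Local v)) ×ˢ (cmLocalIntegralLevel L N₁ H₁ v : Set ((cmDatum L N₁ H₁).Local v))).indicator
            fun _ => 1) :=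
    φ.fin_eventually_eq_indicator.and hunit
  let fv : ∀ v : HeightOneSpectrum (𝓞 ↥(maximalRealSubfield L)), (cmDatum L N₂ H₂).Local v × (cmDatum L N₁ H₁).Local v → ℂ := fun v =>
    if φ.fin v = (localLevelGt L n v : Set (GL (Fin n) (LocalRing L v))).indicator 1 ∧
        (𝔡 v).IsEndoMatch (mt v) (mH v) ((localLevelGt L n v : Set (GL (Fin n) (LocalRing L v))).indicator 1)
          (((cmLocalIntegralLevel L N₂ H₂ v : Set ((cmDatum L N₂ H₂).Local v)) ×ˢ (cmLocalIntegralLevel L N₁ H₁ v : Set ((cmDatum L N₁ H₁).Local v))).indicator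
            fun _ => 1)
      then (((cmLocalIntegralLevel L N₂ H₂ v : Set ((cmDatum L N₂ H₂).Local v)) ×ˢ (cmLocalIntegralLevel L N₁ H₁ v : Set ((cmDatum L N₁ H₁).Local v))).indicator
        fun _ => 1) else g v
  refine ⟨⟨(Filter.eventually_cofinite.mp hP).toFinset, fun v => cmLocalIntegralLevel L N₂ H₂ v, fun v => cmLocalIntegralLevel L N₁ H₁ v, fv, fHa,
      fun v hv => if_pos ?_⟩, fun v => ?_, fun v => ?_, hfHam⟩
  · -- off the bad set the good-set predicate holds
    by_contra hPv
    exact hv ((Set.Finite.mem_toFinset _).mpr hPv)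
  · -- the matching at `v`
    show (𝔡 v).IsEndoMatch (mt v) (mH v) (φ.fin v) (fv v)
    by_cases hv : φ.fin v = (localLevelGt L n v : Set (GL (Fin n) (LocalRing L v))).indicator 1 ∧
        (𝔡 v).IsEndoMatch (mt v) (mH v) ((localLevelGt L n v : Set (GL (Fin n) (LocalRing L v))).indicator 1)
          (((cmLocalIntegralLevel L N₂ H₂ v : Set ((cmDatum L N₂ H₂).Local v)) ×ˢ (cmLocalIntegralLevel L N₁ H₁ v : Set ((cmDatum L N₁ H₁).Local v))).indicator
            fun _ => 1)
    · rw [show fv v = _ from if_pos hv, hv.1]; exact hv.2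
    · rw [show fv v = g v from if_neg hv]; exact (hg v).2
  · -- smoothness of the local factors
    show IsLocSmooth (fv v)
    by_cases hv : φ.fin v = (localLevelGt L n v : Set (GL (Fin n) (LocalRing L v))).indicator 1 ∧
        (𝔡 v).IsEndoMatch (mt v) (mH v) ((localLevelGt L n v : Set (GL (Fin n) (LocalRing L v))).indicator 1)
          (((cmLocalIntegralLevel L N₂ H₂ v : Set ((cmDatum L N₂ H₂).Local v)) ×ˢ (cmLocalIntegralLevel L N₁ H₁ v : Set ((cmDatum L N₁ H₁).Local v))).indicator
            fun _ => 1)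
    · rw [show fv v = _ from if_pos hv]
      exact isLocSmooth_indicator ((isCompact_isOpen_cmLocalIntegralLevel L N₂ H₂ v).2.prod (isCompact_isOpen_cmLocalIntegralLevel L N₁ H₁ v).2)
        ((Subgroup.isClosed_of_isOpen _ (isCompact_isOpen_cmLocalIntegralLevel L N₂ H₂ v).2).prod
          (Subgroup.isClosed_of_isOpen _ (isCompact_isOpen_cmLocalIntegralLevel L N₁ H₁ v).2))
        ((isCompact_isOpen_cmLocalIntegralLevel L N₂ H₂ v).1.prod (isCompact_isOpen_cmLocalIntegralLevel L N₁ H₁ v).1)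
    · rw [show fv v = g v from if_neg hv]; exact (hg v).1

end Summit.HodgeConjecture.HodgeConjecture.Cruxes.H413.K2E1MatchingTriplesConditional

end
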